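import Summits.BirchSwinnertonDyer.Rank1Residual.X11b.AnticyclotomicLocalTorsionDescent
import Summits.BirchSwinnertonDyer.Rank1Residual.X11b.AnticyclotomicControlMap
import Literature.NumberTheory.EllipticCurves.SelmerCorankProofs
import HarnessLib

/-!
# X11b, route R1 — the STRICT local condition at `𝔭` DESCENDS from `K_∞` to `K` under (iv):
# `H¹(K_𝔭, E[p^∞]) ↪ H¹(K_{∞,w}, E[p^∞])` and the `𝔭`-component of `ker g` vanishes (JSW17 §3.3)

HONEST FRAMING (cell `b2b-bsdres`, run/shared/lean/b2b/bsd-rank1-residual/, verbatim in every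
file): the goal of the cell is to DELETE the COMBINATION-SHAPED residual classes of the
Birch–Swinnerton-Dyer formula for ALL analytic-rank `≤ 1` elliptic curves over `ℚ` — "full BSD
formula for every rank `≤ 1` curve in class `C`" assembled STRICTLY from published theorems — so
that the rank-`≤ 1` remainder becomes exactly the CONSTRUCTION-SHAPED classes, which are TYPED
(missing-input `Prop`s), NOT attempted. This is not "finishing BSD". Sub-cell
`b2b-bsdres-multr1-p1` (X11b, route R1 = Castella 2018 Thm. A re-proved along the author's
erratum); a RESEARCH ROUTE; no claim beyond the stated class; X11b stays CONSTRUCTION-SHAPED;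
nothing here changes a label; no named fact is minted (proved theorems only; no `sorry`).

## Why this file

In the control diagram for Castella's Selmer groups (JSW17 §3.3 / Greenberg LNM 1716 §3)

  `0 → Sel_𝔭^Σ(K, E[p^∞]) → H¹(K, E[p^∞]) → ∏_v (local terms over K)`
  `0 → Sel_𝔭^Σ(K_∞, E[p^∞])^Γ → H¹(K_∞, E[p^∞])^Γ → ∏_w (local terms over K_∞)`

the cokernel of `s : Sel(K) → Sel(K_∞)^Γ` (gen 10's `controlMap`, INJECTIVE on route R1) is
controlled by the kernels of the local restriction maps `r_v`. At the STRICT place `𝔭` the local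
term is `H¹(K_𝔭, E[p^∞])` itself over `K` and `∏_{w∣𝔭} H¹(K_{∞,w}, E[p^∞])` over `K_∞`, so
`ker r_𝔭 = ker (H¹(K_𝔭, E[p^∞]) → H¹(K_{∞,w}, E[p^∞])) = H¹(K_{∞,w}/K_𝔭, E(K_{∞,w})[p^∞])`
(inflation–restriction), which VANISHES because `E(K_{∞,w})[p^∞] = 0` — gen 10's consequence of
the erratum's hypothesis (iv) `E(ℚ_p)[p] = 0` (`AnticyclotomicLocalTowerTorsion`,
`AnticyclotomicLocalTorsionDescent`). This file proves that vanishing ON THE TREE'S OBJECTS and draws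
the consequence for the control argument: Castella's STRICT condition at `𝔭` DESCENDS — a class
over `K` whose restriction to `K_∞` is strict at (the chosen place above) `𝔭` is already strict at
`𝔭` over `K`. So hypothesis (iv) is exactly what removes the `𝔭`-component of `ker g`; the
remaining components (`𝔭̄`: relaxed, no condition; `w ∤ p`: the Tamagawa-type kernels
`H¹(K_{∞,w}/K_v, E(K_{∞,w})[p^∞])`, Castella's `Σ` / (5.2)) are not treated here.

## What is proved

Generic (any topological group `G`, discrete `G`-module `M` with continuous orbit maps, subgroups
`H ≤ H'` with `H` normal in `H'`): **`resOfLe_injective_of_fixedPoints`** — if `M` has no nonzero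
`H`-fixed element then `res : H¹(H', M) → H¹(H, M)` is INJECTIVE (inflation–restriction with
`H¹(H'/H, M^H) = H¹(H'/H, 0) = 0`, at the cocycle level: a class dying on `H` is represented by a
cocycle vanishing on `H`, whose values are then `H`-fixed (tree `ResKernel.apply_mem_fixedPoints`),
hence `0`). No topological generator is needed (contrast Greenberg's Lemma 3.1 bound
`#ker ≤ #B/(γ−1)B` used by gen 9 globally).

Curve level, namespace `…X11b.AcSelmer` (any elliptic `E/K`, `K` a number field, `𝔭`, any
`ℤ_p`-extension `κ`, hypothesis "`E(K̄)[p^∞]^{D_𝔭 ⊓ ker κ} = 0`", discharged on route R1 by gen 10):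
* **`resOfLe_decomp_injective`**: `H¹(D_𝔭, E[p^∞]) → H¹(D_𝔭 ⊓ ker κ, E[p^∞])` is injective — i.e.
  `H¹(K_𝔭, E[p^∞]) ↪ H¹(K_{∞,w}, E[p^∞])` for the place `w` of `K_∞` above `𝔭` of the chosen
  embedding (`D_𝔭 ≅ Γ_{K_𝔭}`, `D_𝔭 ⊓ Gal(K̄/K_∞) =` the decomposition group of `K_∞` at `w`);
* **`mem_strictKer_top_of_resOfLe_mem`** / **`resOfLe_mem_strictKer_iff`**: for `c ∈ H¹(⊤, M)`
  (`= H¹(K, M)`), `res_{K→K_∞} c` satisfies Castella's strict condition at `𝔭` over `K_∞` IFF `c`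
  satisfies it over `K` (`strictMap_comp_resOfLe` of `AnticyclotomicControlMap` + the generic
  injectivity for the `D_𝔭`-module `M ⧸ 0` of the strict datum).

Route R1 (namespace `…X11b`): **`resOfLe_decomp_injective_of_aprimeLocusAt`**,
**`ChainLocus.resOfLe_mem_strictKer_iff`** etc.: on the A′-locus / `ChainLocus`, for EVERY number
field `K`, EVERY degree-one `𝔭 ∣ p`, EVERY `ℤ_p`-extension `κ` — the data of `R1ControlOnTreeAt`.

References: [JetchevSkinnerWan2017] §3.3 (arXiv:1512.06894; control, local conditions at `𝔭`;
shape only); [GreenbergLNM1716] §3 pp. 85–90 (the maps `r_v`, Lemma 3.1); [Castella2018Erratum]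
Thm. 1.1 (iv), Lemma 2.1 (pp. 1–2); [SerreGaloisCohomology1997] I.§2.6 (b) (inflation–restriction).
-/

noncomputable section

open scoped Classical

open NumberField IsDedekindDomain Field
open Literature.NumberTheory.EllipticCurves Literature.NumberTheory.EllipticCurves.GreenbergSelmer
open Literature.NumberTheory.GaloisRepresentations

universe u

/-! ## Generic: `res : H¹(H', M) → H¹(H, M)` is injective when `M^H = 0` -/

namespace Summit.BirchSwinnertonDyer.Rank1Residual.X11b.AcSelmer

section Generic

variable {G : Type u} [Group G] [TopologicalSpace G] [IsTopologicalGroup G]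
variable {M : Type u} [AddCommGroup M] [DistribMulAction G M] [TopologicalSpace M]
  [DiscreteTopology M]

/-- **Inflation–restriction with trivial fixed part.** Let `H ≤ H'` be subgroups of a topological
group `G` with `H` normal in `H'`, and `M` a discrete `G`-module with continuous orbit maps. If `M`
has no nonzero element fixed by `H`, then the restriction `res : H¹(H', M) → H¹(H, M)` is injective:
a class restricting to `0` is represented, after subtracting a coboundary, by a cocycle `φ` vanishing
on `H`; its values `φ(g)` are then `H`-fixed (`φ(ng) = φ(g)`, `φ(gn') = φ(g)` for `n, n' ∈ H`, tree
`ResKernel.apply_mem_fixedPoints`), hence `0`. ("`ker(res) = H¹(H'/H, M^H)`", here `= 0`.)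
[cite: SerreGaloisCohomology1997, I.§2.6 (b)] [cite: GreenbergLNM1716, §3 Lemma 3.1 (p. 86)] -/
theorem resOfLe_injective_of_fixedPoints {H H' : Subgroup G} (h : H ≤ H')
    (hN : (H.subgroupOf H').Normal) (hcont : ∀ m : M, Continuous fun g : G ↦ g • m)
    (h0 : ∀ m : M, (∀ x ∈ H, x • m = m) → m = 0) :
    Function.Injective (resOfLe M h) := by
  haveI := hN
  rw [injective_iff_map_eq_zero]
  intro c hc
  obtain ⟨φ, rfl⟩ := oneCocycleClass_surjective _ c
  -- the restricted class is the class of the pulled-back cocycle; it is a coboundary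
  have hres : resOfLe M h (oneCocycleClass _ φ) = oneCocycleClass _
      (contOneCocycles.pullback (subgroupInclusion h)
        (resHomOfEquivariant (subgroupInclusion h) (AddMonoidHom.id M) (fun _ _ ↦ rfl)) φ) :=
    map_oneCocycleClass _ _ _ φ
  rw [hres, oneCocycleClass_eq_zero_iff] at hc
  obtain ⟨v, hv⟩ := hc
  -- subtract the coboundary of `v` on `H'`
  have hcontv : Continuous fun g : H' ↦ g • v := (hcont v).comp continuous_subtype_val
  set φ' := φ - cobCocycle v hcontv with hφ'
  have hφ'H : ∀ n ∈ H.subgroupOf H', φ'.1 n = 0 := by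
    intro n hn
    rw [Subgroup.mem_subgroupOf] at hn
    have key := hv ⟨(n : G), hn⟩
    rw [contOneCocycles.pullback_apply] at key
    change φ.1 (subgroupInclusion h ⟨(n : G), hn⟩) = (⟨(n : G), hn⟩ : H) • v - v at key
    have e : subgroupInclusion h ⟨(n : G), hn⟩ = n := Subtype.ext rfl
    rw [e] at key
    rw [hφ', Submodule.coe_sub, ContinuousMap.sub_apply, cobCocycle_apply, key, sub_eq_zero]
    rfl
  -- its values are `H`-fixed, hence zero
  have hφ'0 : φ' = 0 := by
    apply Subtype.ext
    ext g
    have hfix := ResKernel.apply_mem_fixedPoints (H.subgroupOf H') M φ' hφ'H g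
    have h0g : φ'.1 g = 0 := h0 _ fun x hx ↦ hfix ⟨⟨x, h hx⟩, Subgroup.mem_subgroupOf.mpr hx⟩
    rw [h0g]
    rfl
  have hcls : oneCocycleClass _ φ - oneCocycleClass _ (cobCocycle v hcontv) = 0 := by
    rw [← oneCocycleClass_sub, ← hφ', hφ'0, oneCocycleClass_zero]
  rwa [oneCocycleClass_cobCocycle, sub_zero] at hcls

end Generic

/-! ## `H¹(K_𝔭, E[p^∞]) ↪ H¹(K_{∞,w}, E[p^∞])` and descent of the strict condition at `𝔭` -/

section Curve

variable {K : Type u} [Field K] [NumberField K] (W : WeierstrassCurve K) (p : ℕ) [Fact p.Prime]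
  (κ : ZpExtension K p) (𝔭 : HeightOneSpectrum (𝓞 K))

/-- `D_𝔭 ⊓ ker κ` is normal in `D_𝔭` (`ker κ` is normal in `Γ_K`). [folklore] -/
theorem normal_decomp_inf_kerSubgroup :
    ((decomp 𝔭 ⊓ κ.kerSubgroup).subgroupOf (decomp 𝔭)).Normal := by
  rw [Subgroup.normal_subgroupOf_iff inf_le_left]
  intro n g hn hg
  obtain ⟨hnD, hnk⟩ := Subgroup.mem_inf.mp hn
  refine Subgroup.mem_inf.mpr ⟨(decomp 𝔭).mul_mem ((decomp 𝔭).mul_mem hg hnD)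
    ((decomp 𝔭).inv_mem hg), ?_⟩
  rw [ZpExtension.mem_kerSubgroup] at hnk ⊢
  rw [map_mul, map_mul, map_inv, hnk, mul_one, mul_inv_cancel]

/-- **`H¹(K_𝔭, E[p^∞]) ↪ H¹(K_{∞,w}, E[p^∞])`.** For an elliptic curve `E/K`, a prime `𝔭`, a
`ℤ_p`-extension `κ` with `E(K̄)[p^∞]^{D_𝔭 ⊓ ker κ} = 0` (`E(K_{∞,w})[p^∞] = 0`, gen 10, from
"`E(K_𝔭)[p] = 0`"): the restriction `H¹(D_𝔭, E[p^∞]) → H¹(D_𝔭 ⊓ ker κ, E[p^∞])` is injective — the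
local kernel `H¹(K_{∞,w}/K_𝔭, E(K_{∞,w})[p^∞])` at the strict place vanishes.
[cite: JetchevSkinnerWan2017, §3.3 (control; local conditions at `𝔭`; shape only)] [cite: GreenbergLNM1716, §3 p. 86 (the maps `r_v`)] -/
theorem resOfLe_decomp_injective
    (h0 : FixedPoints.addSubgroup ↥(decomp 𝔭 ⊓ κ.kerSubgroup) (W.geomPrimaryTorsion p) = ⊥) :
    Function.Injective
      (resOfLe (W.geomPrimaryTorsion p) (inf_le_left : decomp 𝔭 ⊓ κ.kerSubgroup ≤ decomp 𝔭)) := by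
  refine resOfLe_injective_of_fixedPoints inf_le_left (normal_decomp_inf_kerSubgroup p κ 𝔭)
    (W.continuous_smul_geomPrimaryTorsion p) fun m hm ↦ ?_
  have : m ∈ FixedPoints.addSubgroup ↥(decomp 𝔭 ⊓ κ.kerSubgroup) (W.geomPrimaryTorsion p) :=
    fun x ↦ hm x x.2
  rwa [h0, AddSubgroup.mem_bot] at this

variable {M : Type u} [AddCommGroup M] [DistribMulAction (absoluteGaloisGroup K) M]
  [TopologicalSpace M] [DiscreteTopology M]

omit [TopologicalSpace M] [DiscreteTopology M] in
/-- The quotient `M ⧸ 0` of the STRICT datum has no nonzero element fixed by a subgroup `N ≤ D_𝔭`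
when `M` has none (`δ • (m mod 0) = (δ • m) mod 0`, `smul_grMk`; `ker grMk = 0`). [folklore] -/
theorem strictDatum_gr_eq_zero_of_fixed (N : Subgroup (absoluteGaloisGroup K)) (hN : N ≤ decomp 𝔭)
    (h0 : ∀ m : M, (∀ x ∈ N, x • m = m) → m = 0) (q : (strictDatum M 𝔭).Gr)
    (hq : ∀ x : decomp 𝔭, (x : absoluteGaloisGroup K) ∈ N → x • q = q) : q = 0 := by
  obtain ⟨m, rfl⟩ := (strictDatum M 𝔭).grMk_surjective q
  have hm : ∀ x ∈ N, x • m = m := fun x hx ↦ by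
    have key := hq ⟨x, hN hx⟩ hx
    rw [LocalDatum.smul_grMk, ← sub_eq_zero, ← map_sub, ← AddMonoidHom.mem_ker,
      LocalDatum.ker_grMk] at key
    change x • m - m ∈ (⊥ : AddSubgroup M) at key
    rwa [AddSubgroup.mem_bot, sub_eq_zero] at key
  rw [h0 m hm, map_zero]

/-- **Descent of Castella's STRICT condition at `𝔭` from `K_∞` to `K`.** For a discrete
`Γ_K`-module `M` with continuous orbit maps and NO nonzero element fixed by `D_𝔭 ⊓ ker κ`, and a
class `c ∈ H¹(⊤, M) = H¹(K, M)`: if `res_{K→K_∞} c` satisfies the strict condition at (the chosen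
place above) `𝔭` over `K_∞`, then `c` satisfies it over `K`. Proof:
`strictMap_{ker κ} ∘ res = res_{D_𝔭 → D_𝔭 ⊓ ker κ} ∘ strictMap_⊤` (`strictMap_comp_resOfLe`) and
the right-hand restriction (for the `D_𝔭`-module `M ⧸ 0`) is injective
(`resOfLe_injective_of_fixedPoints`). The `𝔭`-component of `ker g` in the control diagram vanishes.
[cite: JetchevSkinnerWan2017, §3.3 (control; shape only)] [cite: GreenbergLNM1716, §3 pp. 85–86 (`ker g_n`)] -/
theorem mem_strictKer_top_of_resOfLe_mem (hcont : ∀ m : M, Continuous fun g : absoluteGaloisGroup K ↦ g • m)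
    (h0 : ∀ m : M, (∀ x ∈ decomp 𝔭 ⊓ κ.kerSubgroup, x • m = m) → m = 0)
    {c : subgroupH1 (⊤ : Subgroup (absoluteGaloisGroup K)) M}
    (hc : resOfLe M (le_top : κ.kerSubgroup ≤ ⊤) c ∈ (strictDatum M 𝔭).strictKer κ.kerSubgroup) :
    c ∈ (strictDatum M 𝔭).strictKer ⊤ := by
  rw [LocalDatum.mem_strictKer_iff] at hc ⊢
  rw [← AddMonoidHom.comp_apply, strictMap_comp_resOfLe (le_top : κ.kerSubgroup ≤ ⊤) (strictDatum M 𝔭),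
    AddMonoidHom.comp_apply] at hc
  -- the restriction `H¹(decompIn ⊤ 𝔭, Gr) → H¹(decompIn (ker κ) 𝔭, Gr)` is injective
  have hnormal : ((decompIn κ.kerSubgroup 𝔭).subgroupOf (decompIn ⊤ 𝔭)).Normal := by
    rw [Subgroup.normal_subgroupOf_iff (decompIn_mono (le_top : κ.kerSubgroup ≤ ⊤) 𝔭)]
    intro n g hn _
    rw [mem_decompIn_iff] at hn ⊢
    rw [ZpExtension.mem_kerSubgroup] at hn ⊢
    rw [Subgroup.coe_mul, Subgroup.coe_mul, Subgroup.coe_inv, map_mul, map_mul, map_inv, hn,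
      mul_one, mul_inv_cancel]
  have hcontGr : ∀ q : (strictDatum M 𝔭).Gr, Continuous fun δ : decomp 𝔭 ↦ δ • q := fun q ↦ by
    obtain ⟨m, rfl⟩ := (strictDatum M 𝔭).grMk_surjective q
    have e : (fun δ : decomp 𝔭 ↦ δ • (strictDatum M 𝔭).grMk m) =
        (strictDatum M 𝔭).grMk ∘ (fun g : absoluteGaloisGroup K ↦ g • m) ∘ Subtype.val := by
      funext δ; rw [LocalDatum.smul_grMk]; rfl
    rw [e]
    exact continuous_of_discreteTopology.comp ((hcont m).comp continuous_subtype_val)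
  have hinj := resOfLe_injective_of_fixedPoints (G := decomp 𝔭) (M := (strictDatum M 𝔭).Gr)
    (decompIn_mono (le_top : κ.kerSubgroup ≤ ⊤) 𝔭) hnormal hcontGr fun q hq ↦
      strictDatum_gr_eq_zero_of_fixed 𝔭 (decomp 𝔭 ⊓ κ.kerSubgroup) inf_le_left h0 q
        fun x hx ↦ hq x ((mem_decompIn_iff _ _ x).2 (Subgroup.mem_inf.mp hx).2)
  exact (injective_iff_map_eq_zero _).mp hinj _ hc

/-- **The strict condition at `𝔭`: over `K_∞` after restriction IFF over `K`** (→ by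
`mem_strictKer_top_of_resOfLe_mem`, ← by `resOfLe_mem_strictKer`).
[cite: JetchevSkinnerWan2017, §3.3 (control; shape only)] -/
theorem resOfLe_mem_strictKer_iff (hcont : ∀ m : M, Continuous fun g : absoluteGaloisGroup K ↦ g • m)
    (h0 : ∀ m : M, (∀ x ∈ decomp 𝔭 ⊓ κ.kerSubgroup, x • m = m) → m = 0)
    (c : subgroupH1 (⊤ : Subgroup (absoluteGaloisGroup K)) M) :
    resOfLe M (le_top : κ.kerSubgroup ≤ ⊤) c ∈ (strictDatum M 𝔭).strictKer κ.kerSubgroup ↔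
      c ∈ (strictDatum M 𝔭).strictKer ⊤ :=
  ⟨mem_strictKer_top_of_resOfLe_mem p κ 𝔭 hcont h0, resOfLe_mem_strictKer le_top _⟩

/-- Curve form: for `E/K` with `E(K̄)[p^∞]^{D_𝔭 ⊓ ker κ} = 0`, a class `c ∈ H¹(K, E[p^∞])` is strict at
`𝔭` over `K` iff its restriction to `K_∞` is strict at (the chosen place above) `𝔭`.
[cite: JetchevSkinnerWan2017, §3.3 (control; shape only)] [cite: Castella2018, Def. 2.2 (arXiv:1704.06608 p. 5)] -/
theorem resOfLe_mem_strictKer_iff_of_fixedPoints_eq_bot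
    (h0 : FixedPoints.addSubgroup ↥(decomp 𝔭 ⊓ κ.kerSubgroup) (W.geomPrimaryTorsion p) = ⊥)
    (c : W.subgroupH1 p (⊤ : Subgroup (absoluteGaloisGroup K))) :
    W.resOfLe p (le_top : κ.kerSubgroup ≤ ⊤) c ∈
        (strictDatum (W.geomPrimaryTorsion p) 𝔭).strictKer κ.kerSubgroup ↔
      c ∈ (strictDatum (W.geomPrimaryTorsion p) 𝔭).strictKer ⊤ := by
  refine resOfLe_mem_strictKer_iff p κ 𝔭 (W.continuous_smul_geomPrimaryTorsion p) (fun m hm ↦ ?_) c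
  have : m ∈ FixedPoints.addSubgroup ↥(decomp 𝔭 ⊓ κ.kerSubgroup) (W.geomPrimaryTorsion p) :=
    fun x ↦ hm x x.2
  rwa [h0, AddSubgroup.mem_bot] at this

end Curve

end Summit.BirchSwinnertonDyer.Rank1Residual.X11b.AcSelmer

/-! ## Route R1: the A′-locus, degree-one `𝔭 ∣ p`, any `ℤ_p`-extension -/

namespace Summit.BirchSwinnertonDyer.Rank1Residual.X11b

section RouteR1

open AcSelmer Literature.NumberTheory.EllipticCurves.Rank1Residual
  Literature.NumberTheory.EllipticCurves.Rank1Residual.Typed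

variable (W : WeierstrassCurve ℚ) [W.IsElliptic] [W.IsGloballyMinimal] (p : ℕ) [Fact p.Prime]

/-- **On the A′-locus: `H¹(K_𝔭, E[p^∞]) ↪ H¹(K_{∞,w}, E[p^∞])`** for every number field `K`, every
degree-one `𝔭 ∣ p`, every `ℤ_p`-extension `κ` — hypothesis (iv) `E(ℚ_p)[p] = 0` at work
(`fixedPoints_decomp_inf_kerSubgroup_eq_bot_of_aprimeLocusAt`).
[cite: Castella2018Erratum, Thm. 1.1 (iv), Lemma 2.1 (pp. 1–2)] [cite: JetchevSkinnerWan2017, §3.3 (control; shape only)] -/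
theorem resOfLe_decomp_injective_of_aprimeLocusAt (hloc : X11.AprimeLocusAt W p)
    (K : Type) [Field K] [NumberField K] (κ : ZpExtension K p) (𝔭 : HeightOneSpectrum (𝓞 K))
    (h𝔭 : ((p : ℕ) : 𝓞 K) ∈ 𝔭.asIdeal) (he : 𝔭.asIdeal.ramificationIdx (𝓞 ℚ) = 1)
    (hf : 𝔭.asIdeal.inertiaDeg (𝓞 ℚ) = 1) :
    Function.Injective (resOfLe ((W.baseChange K).geomPrimaryTorsion p)
      (inf_le_left : decomp 𝔭 ⊓ κ.kerSubgroup ≤ decomp 𝔭)) :=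
  resOfLe_decomp_injective (W.baseChange K) p κ 𝔭
    (fixedPoints_decomp_inf_kerSubgroup_eq_bot_of_aprimeLocusAt W p hloc K κ 𝔭 h𝔭 he hf)

/-- **On the A′-locus: Castella's strict condition at `𝔭` descends from `K_∞` to `K`** (every number
field, every degree-one `𝔭 ∣ p`, every `ℤ_p`-extension): for `c ∈ H¹(K, E[p^∞])`,
`res_{K→K_∞} c` strict at `𝔭` ⟺ `c` strict at `𝔭`. [cite: Castella2018Erratum, Thm. 1.1 (iv) (p. 1)] [cite: JetchevSkinnerWan2017, §3.3 (control; shape only)] -/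
theorem resOfLe_mem_strictKer_iff_of_aprimeLocusAt (hloc : X11.AprimeLocusAt W p)
    (K : Type) [Field K] [NumberField K] (κ : ZpExtension K p) (𝔭 : HeightOneSpectrum (𝓞 K))
    (h𝔭 : ((p : ℕ) : 𝓞 K) ∈ 𝔭.asIdeal) (he : 𝔭.asIdeal.ramificationIdx (𝓞 ℚ) = 1)
    (hf : 𝔭.asIdeal.inertiaDeg (𝓞 ℚ) = 1)
    (c : (W.baseChange K).subgroupH1 p (⊤ : Subgroup (absoluteGaloisGroup K))) :
    (W.baseChange K).resOfLe p (le_top : κ.kerSubgroup ≤ ⊤) c ∈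
        (strictDatum ((W.baseChange K).geomPrimaryTorsion p) 𝔭).strictKer κ.kerSubgroup ↔
      c ∈ (strictDatum ((W.baseChange K).geomPrimaryTorsion p) 𝔭).strictKer ⊤ :=
  resOfLe_mem_strictKer_iff_of_fixedPoints_eq_bot (W.baseChange K) p κ 𝔭
    (fixedPoints_decomp_inf_kerSubgroup_eq_bot_of_aprimeLocusAt W p hloc K κ 𝔭 h𝔭 he hf) c

variable {W p}

/-- **On route R1's population (`ChainLocus`)**: the strict condition at a degree-one `𝔭 ∣ p`
descends from `K_∞` to `K`, for every number field `K` and every `ℤ_p`-extension `κ` (in particular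
an erratum field, its primes `𝔭, 𝔭̄` above the split `p`, and the anticyclotomic `κ`: the data of
`R1ControlOnTreeAt`). [cite: Castella2018Erratum, Thm. A′ (p. 1), Thm. 1.1 (iv)] [cite: JetchevSkinnerWan2017, §3.3 (control; shape only)] -/
theorem ChainLocus.resOfLe_mem_strictKer_iff (h : ChainLocus W p)
    (K : Type) [Field K] [NumberField K] (κ : ZpExtension K p) (𝔭 : HeightOneSpectrum (𝓞 K))
    (h𝔭 : ((p : ℕ) : 𝓞 K) ∈ 𝔭.asIdeal) (he : 𝔭.asIdeal.ramificationIdx (𝓞 ℚ) = 1)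
    (hf : 𝔭.asIdeal.inertiaDeg (𝓞 ℚ) = 1)
    (c : (W.baseChange K).subgroupH1 p (⊤ : Subgroup (absoluteGaloisGroup K))) :
    (W.baseChange K).resOfLe p (le_top : κ.kerSubgroup ≤ ⊤) c ∈
        (strictDatum ((W.baseChange K).geomPrimaryTorsion p) 𝔭).strictKer κ.kerSubgroup ↔
      c ∈ (strictDatum ((W.baseChange K).geomPrimaryTorsion p) 𝔭).strictKer ⊤ :=
  resOfLe_mem_strictKer_iff_of_aprimeLocusAt W p h.erratumHypotheses.2.2.2 K κ 𝔭 h𝔭 he hf c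

/-- **On `ChainLocus`: `H¹(K_𝔭, E[p^∞]) ↪ H¹(K_{∞,w}, E[p^∞])`** at every degree-one `𝔭 ∣ p`, every
`ℤ_p`-extension. [cite: Castella2018Erratum, Thm. 1.1 (iv), Lemma 2.1 (pp. 1–2)] -/
theorem ChainLocus.resOfLe_decomp_injective (h : ChainLocus W p)
    (K : Type) [Field K] [NumberField K] (κ : ZpExtension K p) (𝔭 : HeightOneSpectrum (𝓞 K))
    (h𝔭 : ((p : ℕ) : 𝓞 K) ∈ 𝔭.asIdeal) (he : 𝔭.asIdeal.ramificationIdx (𝓞 ℚ) = 1)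
    (hf : 𝔭.asIdeal.inertiaDeg (𝓞 ℚ) = 1) :
    Function.Injective (resOfLe ((W.baseChange K).geomPrimaryTorsion p)
      (inf_le_left : decomp 𝔭 ⊓ κ.kerSubgroup ≤ decomp 𝔭)) :=
  resOfLe_decomp_injective_of_aprimeLocusAt W p h.erratumHypotheses.2.2.2 K κ 𝔭 h𝔭 he hf

end RouteR1

end Summit.BirchSwinnertonDyer.Rank1Residual.X11b

end
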